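import Summits.HubbardSuperconductivity.HubbardSuperconductivity.Theorems.SoloBlindCrutchCarrierCeiling
import HarnessLib

/-!
# The carrier ceiling on the whole half-plane `U > 160 g` of the crutch plane

Solo-blind lineage, Theorem 40′ (generation 52) — a corollary-grade completion of Theorem 40
(`SoloBlindCrutchCarrierCeiling`). Setting as there: the BCS-crutch family
`K_{U,g} = hubbardTorus 2 L 1 U - (g/L²) Δ_dᴴΔ_d` (`g ≥ 0`, sector `(2n, S^z = 0)`, `L ≥ 3`),
a normalised sector ground state `φ` of `K_{U,g}`, and `Y = re⟨φ, Δ_dᴴΔ_d φ⟩` (the `d`-wave pair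
order; density `Y/L⁴`).

Theorem 40(c) (`crutch_groundState_carrier_ceiling`) is the inequality
`(U - 160 g)·Y ≤ 80 U L²(L² - 2n + 3) + 1280 L² n` for all `U ≥ 0`, `g ≥ 0`; Theorem 40(d)–(f) read
it only on `U ≥ 320 g`, where `U/(U - 160 g) ≤ 2`. This file reads it on the whole open half-plane
`U > 160 g`, with the degradation factor `U/(U - 160 g)` explicit:

* `crutch_groundState_carrier_ceiling_of_gt` — **(c′)** for `0 ≤ g`, `160 g < U`:
  `Y ≤ (80 U L²(L² - 2n + 3) + 1280 L² n)/(U - 160 g)`.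
* `crutch_groundState_carrier_ceiling_doped_of_gt` — **(d″)** in the doped sector
  `n = ⌊(1-δ)L²/2⌋`, `δ ∈ [0,1]`: `Y ≤ ((80 U δ + 640)/(U - 160 g))·L⁴ + (400 U/(U - 160 g))·L²`,
  i.e. density `≤ (U/(U - 160 g))·(80 δ + 640/U) + O(L⁻²)`.
* `liminf_dWavePairFieldCorr_crutch_le_carrier_of_gt` — **(e′)** the summit's order functional of
  EVERY normalised ground-state family of `K_{U,g}` in the summit's sectors has
  `liminf ≤ (80 U δ + 640)/(U - 160 g)` whenever `U > 160 g`.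
* `strip_constant_le_of_le` — **(g)** consistency with Theorem 40(e): for `U ≥ 320 g`, `U > 0`,
  `(80 U δ + 640)/(U - 160 g) ≤ 160 δ + 1280/U`, so (e′) ∘ (g) re-proves Theorem 40(e) on its domain.

Reading (obstruction report §5.20, the `(U, g)` map). The carrier ceiling of Theorem 40 is not a
feature of very strong coupling `U ≥ 320 g` only: it holds on the open half-plane `U > 160 g` with
constant `(U/(U - 160 g))·(80 δ + 640/U)`, blowing up only at the line `U = 160 g`; below that line
(in particular on the whole open box of obstruction W3 near `g = 0⁺` at SMALL `U ≤ 160 g`) no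
carrier ceiling of this kind is claimed — there the every-ground-state ceilings are the budget
ceilings of Theorems 37/38. Honest label: corollary-grade (division of Theorem 40(c) by
`U - 160 g > 0` and the liminf bookkeeping of Theorem 40(e)); no claim toward the summit.
[this work; inputs folklore]
-/

noncomputable section

namespace Summit.HubbardSuperconductivity.HubbardSuperconductivity.Theorems.CrutchCarrierCeilingStrip

open Matrix Finset Filter Literature.Probability.LatticeModels
  Literature.MathematicalPhysics.QuantumLattice
  Literature.MathematicalPhysics.QuantumLattice.EigenvalueContinuation
  Summit.HubbardSuperconductivity.HubbardSuperconductivity.Theorems.CrutchCarrierCeiling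
open scoped ComplexOrder

variable {L : ℕ} [NeZero L]

/-! ### (c′) The carrier ceiling on `U > 160 g` -/

/-- **(c′) Carrier ceiling on the crutch plane, `U > 160 g`.** `L ≥ 3`, `0 ≤ g`, `160 g < U`,
`2n ≤ L²`; `φ` a normalised ground state of `K_{U,g}` in the sector `(2n, 0)`. Then
`re⟨φ, Δ_dᴴΔ_d φ⟩ ≤ (80 U L²(L² - 2n + 3) + 1280 L² n)/(U - 160 g)` — Theorem 40(c) divided by
`U - 160 g > 0`. [this work; inputs folklore] -/
theorem crutch_groundState_carrier_ceiling_of_gt (hL : 3 ≤ L) {U g : ℝ} (hg : 0 ≤ g)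
    (hUg : 160 * g < U) {n : ℕ} (hn : 2 * n ≤ L ^ 2)
    {φ : Fock (Orb (FermionTorus 2 L))} (hφ1 : star φ ⬝ᵥ φ = 1)
    (hφ : IsGroundStateInSector
      (hubbardTorus 2 L 1 U + ((-(g / (L : ℝ) ^ 2) : ℝ) : ℂ) •
        ((pairField dWaveFormFactor L)ᴴ * pairField dWaveFormFactor L)) (2 * n) 0 φ) :
    (star φ ⬝ᵥ (((pairField dWaveFormFactor L)ᴴ * pairField dWaveFormFactor L) *ᵥ φ)).re ≤
      (80 * U * (L : ℝ) ^ 2 * ((L : ℝ) ^ 2 - 2 * n + 3) + 1280 * (L : ℝ) ^ 2 * n) /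
        (U - 160 * g) := by
  have hU : 0 ≤ U := by linarith
  have hpos : 0 < U - 160 * g := by linarith
  have hc := crutch_groundState_carrier_ceiling hL hU hg hn hφ1 hφ
  rw [le_div_iff₀ hpos]
  linarith

/-! ### (d″) The doped sector -/

/-- **(d″) The doped sector, `U > 160 g`.** `L ≥ 3`, `δ ∈ [0, 1]`, `0 ≤ g`, `160 g < U`; `φ` a
normalised ground state of `K_{U,g}` in the sector `(2⌊(1-δ)L²/2⌋, S^z = 0)`. Then
`re⟨φ, Δ_dᴴΔ_d φ⟩ ≤ ((80 U δ + 640)/(U - 160 g))·L⁴ + (400 U/(U - 160 g))·L²`, i.e. order density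
`≤ (U/(U - 160 g))·(80 δ + 640/U) + (400 U/(U - 160 g))/L²`. At `U ≥ 320 g` this is Theorem 40(d′)
(`crutch_groundState_carrier_ceiling_doped`) up to the bookkeeping of (g). [this work; inputs folklore] -/
theorem crutch_groundState_carrier_ceiling_doped_of_gt (hL : 3 ≤ L) {δ U g : ℝ} (hδ0 : 0 ≤ δ)
    (hδ1 : δ ≤ 1) (hg : 0 ≤ g) (hUg : 160 * g < U)
    {φ : Fock (Orb (FermionTorus 2 L))} (hφ1 : star φ ⬝ᵥ φ = 1)
    (hφ : IsGroundStateInSector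
      (hubbardTorus 2 L 1 U + ((-(g / (L : ℝ) ^ 2) : ℝ) : ℂ) •
        ((pairField dWaveFormFactor L)ᴴ * pairField dWaveFormFactor L))
      (2 * ⌊(1 - δ) * (L : ℝ) ^ 2 / 2⌋₊) 0 φ) :
    (star φ ⬝ᵥ (((pairField dWaveFormFactor L)ᴴ * pairField dWaveFormFactor L) *ᵥ φ)).re ≤
      (80 * U * δ + 640) / (U - 160 * g) * (L : ℝ) ^ 4 +
        400 * U / (U - 160 * g) * (L : ℝ) ^ 2 := by
  set n : ℕ := ⌊(1 - δ) * (L : ℝ) ^ 2 / 2⌋₊ with hn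
  have hU : 0 ≤ U := by linarith
  have hpos : 0 < U - 160 * g := by linarith
  have hL2 : (0 : ℝ) ≤ (L : ℝ) ^ 2 := by positivity
  have hy : 0 ≤ (1 - δ) * (L : ℝ) ^ 2 / 2 := by
    have : 0 ≤ 1 - δ := by linarith
    positivity
  have hNle : (2 * (n : ℝ)) ≤ (1 - δ) * (L : ℝ) ^ 2 := by
    have hfl := Nat.floor_le hy
    linarith
  have hNge : (1 - δ) * (L : ℝ) ^ 2 - 2 ≤ 2 * (n : ℝ) := by
    have hfl := Nat.lt_floor_add_one ((1 - δ) * (L : ℝ) ^ 2 / 2)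
    linarith
  have h2nR : (2 * (n : ℝ)) ≤ (L : ℝ) ^ 2 := by nlinarith
  have h2n : 2 * n ≤ L ^ 2 := by exact_mod_cast h2nR
  have hc := crutch_groundState_carrier_ceiling hL hU hg h2n hφ1 hφ
  -- the two pieces of the numerator
  have hA : 80 * U * (L : ℝ) ^ 2 * ((L : ℝ) ^ 2 - 2 * n + 3) ≤
      80 * U * (L : ℝ) ^ 2 * (δ * (L : ℝ) ^ 2 + 5) :=
    mul_le_mul_of_nonneg_left (by linarith) (by positivity)
  have hB : 1280 * (L : ℝ) ^ 2 * n ≤ 640 * (L : ℝ) ^ 2 * (L : ℝ) ^ 2 := by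
    nlinarith [mul_le_mul_of_nonneg_left h2nR hL2]
  have key : (U - 160 * g) *
      (star φ ⬝ᵥ (((pairField dWaveFormFactor L)ᴴ * pairField dWaveFormFactor L) *ᵥ φ)).re ≤
      (80 * U * δ + 640) * (L : ℝ) ^ 4 + 400 * U * (L : ℝ) ^ 2 := by
    have hid : 80 * U * (L : ℝ) ^ 2 * (δ * (L : ℝ) ^ 2 + 5) + 640 * (L : ℝ) ^ 2 * (L : ℝ) ^ 2 =
        (80 * U * δ + 640) * (L : ℝ) ^ 4 + 400 * U * (L : ℝ) ^ 2 := by ring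
    linarith
  have h1 : (star φ ⬝ᵥ (((pairField dWaveFormFactor L)ᴴ * pairField dWaveFormFactor L) *ᵥ φ)).re ≤
      ((80 * U * δ + 640) * (L : ℝ) ^ 4 + 400 * U * (L : ℝ) ^ 2) / (U - 160 * g) := by
    rw [le_div_iff₀ hpos]
    linarith
  calc (star φ ⬝ᵥ (((pairField dWaveFormFactor L)ᴴ * pairField dWaveFormFactor L) *ᵥ φ)).re
      ≤ ((80 * U * δ + 640) * (L : ℝ) ^ 4 + 400 * U * (L : ℝ) ^ 2) / (U - 160 * g) := h1
    _ = (80 * U * δ + 640) / (U - 160 * g) * (L : ℝ) ^ 4 +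
          400 * U / (U - 160 * g) * (L : ℝ) ^ 2 := by ring

/-! ### (e′) The summit's order functional of crutched ground-state families, `U > 160 g` -/

/-- **(e′) The carrier ceiling on the summit's order functional, on the half-plane `U > 160 g`.**
Let `0 ≤ g`, `160 g < U`, `δ ∈ [0, 1]`, and let `ψ` satisfy the hypothesis clause of the summit
statement with `K_{U,g}` in place of `H_U` (written at the sides `m + 1`, as in Theorem 40(e)): at
every even side `L`, `ψ L` is normalised and is a ground state of `K_{U,g}(L)` in the sector
`(2⌊(1-δ)L²/2⌋, S^z = 0)`. Then
`liminf_k |Λ_{2k}|⁻² Σ_{x,y ∈ Λ_{2k}} torusPullback (pairFieldCorr g_d ψ) (2k) x y ≤ (80 U δ + 640)/(U - 160 g)`.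
(The `k`-th term is `(2k)⁻⁴ re⟨ψ_{2k}, Δ_dᴴΔ_d ψ_{2k}⟩` by `torusLROSeq_pairFieldCorr_succ`, `≥ 0`,
and `≤ (80 U δ + 640)/(U - 160 g) + (400 U/(U - 160 g))/(2k)²` by (d″).) For `U ≥ 320 g` the
constant is at most Theorem 40(e)'s `160 δ + 1280/U` by (g). [this work; inputs folklore] -/
theorem liminf_dWavePairFieldCorr_crutch_le_carrier_of_gt {U δ g : ℝ} (hg : 0 ≤ g)
    (hUg : 160 * g < U) (hδ0 : 0 ≤ δ) (hδ1 : δ ≤ 1)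
    (ψ : ∀ L, Fock (Orb (FermionTorus 2 L)))
    (hGS : ∀ m : ℕ, Even (m + 1) → star (ψ (m + 1)) ⬝ᵥ ψ (m + 1) = 1 ∧
      IsGroundStateInSector
        (hubbardTorus 2 (m + 1) 1 U + ((-(g / ((m + 1 : ℕ) : ℝ) ^ 2) : ℝ) : ℂ) •
          ((pairField dWaveFormFactor (m + 1))ᴴ * pairField dWaveFormFactor (m + 1)))
        (2 * ⌊(1 - δ) * ((m + 1 : ℕ) : ℝ) ^ 2 / 2⌋₊) 0 (ψ (m + 1))) :
    liminf (fun k : ℕ => (∑ x ∈ halfOpenBox 2 (2 * k), ∑ y ∈ halfOpenBox 2 (2 * k),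
        torusPullback (pairFieldCorr dWaveFormFactor ψ) (2 * k) x y) /
          ((#(halfOpenBox 2 (2 * k)) : ℝ)) ^ 2) atTop ≤
      (80 * U * δ + 640) / (U - 160 * g) := by
  have hpos : 0 < U - 160 * g := by linarith
  have hU : 0 < U := by linarith
  set C : ℝ := (80 * U * δ + 640) / (U - 160 * g) with hC
  set T : ℝ := 400 * U / (U - 160 * g) with hT
  have hT0 : 0 < T := by positivity
  set u : ℕ → ℝ := fun k => (∑ x ∈ halfOpenBox 2 (2 * k), ∑ y ∈ halfOpenBox 2 (2 * k),
      torusPullback (pairFieldCorr dWaveFormFactor ψ) (2 * k) x y) /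
        ((#(halfOpenBox 2 (2 * k)) : ℝ)) ^ 2 with hu
  change liminf u atTop ≤ C
  -- the `k`-th term for `k ≥ 1`, and its sign
  have hterm : ∀ k : ℕ, 1 ≤ k → ∃ n : ℕ, 2 * k = n + 1 ∧
      u k = (star (ψ (n + 1)) ⬝ᵥ (((pairField dWaveFormFactor (n + 1))ᴴ *
        pairField dWaveFormFactor (n + 1)) *ᵥ ψ (n + 1))).re / ((n + 1 : ℕ) : ℝ) ^ 4 := by
    intro k hk
    refine ⟨2 * k - 1, by omega, ?_⟩
    have e : 2 * k = (2 * k - 1) + 1 := by omega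
    simp only [hu]
    rw [e, torusLROSeq_pairFieldCorr_succ]
    rfl
  have hnonneg : ∀ k : ℕ, 1 ≤ k → 0 ≤ u k := by
    intro k hk
    obtain ⟨n, -, hn⟩ := hterm k hk
    rw [hn]
    refine div_nonneg ?_ (by positivity)
    exact (posSemidef_conjTranspose_mul_self (pairField dWaveFormFactor (n + 1))).re_dotProduct_nonneg
      (ψ (n + 1))
  have hbdd : IsBoundedUnder (· ≥ ·) atTop u :=
    isBoundedUnder_of_eventually_ge (a := 0)
      (Filter.eventually_atTop.2 ⟨1, fun k hk => hnonneg k hk⟩)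
  -- for every `c > C`, eventually `u k ≤ c`
  have hev : ∀ c : ℝ, C < c → ∀ᶠ k in atTop, u k ≤ c := by
    intro c hc
    have hε : 0 < c - C := by linarith
    rw [Filter.eventually_atTop]
    refine ⟨⌈T / (c - C)⌉₊ + 2, fun k hk => ?_⟩
    obtain ⟨n, hn2, hn⟩ := hterm k (by omega)
    obtain ⟨hnorm, hgs⟩ := hGS n ⟨k, by omega⟩
    have hL3 : 3 ≤ n + 1 := by omega
    have hside := crutch_groundState_carrier_ceiling_doped_of_gt (L := n + 1) hL3 hδ0 hδ1 hg hUg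
      hnorm hgs
    rw [← hC, ← hT] at hside
    have hL1 : (1 : ℝ) ≤ ((n + 1 : ℕ) : ℝ) := by exact_mod_cast (show 1 ≤ n + 1 by omega)
    have hL2 : (0 : ℝ) < ((n + 1 : ℕ) : ℝ) ^ 2 := by positivity
    have hLk : (⌈T / (c - C)⌉₊ : ℝ) + 2 ≤ ((n + 1 : ℕ) : ℝ) := by
      have : ⌈T / (c - C)⌉₊ + 2 ≤ n + 1 := by omega
      exact_mod_cast this
    have hceil : T / (c - C) ≤ (⌈T / (c - C)⌉₊ : ℝ) := Nat.le_ceil _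
    have hdiv : T / (c - C) < ((n + 1 : ℕ) : ℝ) := by linarith
    have h4 : T < (c - C) * ((n + 1 : ℕ) : ℝ) := by
      have := (div_lt_iff₀ hε).1 hdiv
      linarith
    have hLL : ((n + 1 : ℕ) : ℝ) ≤ ((n + 1 : ℕ) : ℝ) ^ 2 := by
      nlinarith [mul_le_mul_of_nonneg_left hL1 (show (0 : ℝ) ≤ ((n + 1 : ℕ) : ℝ) by positivity)]
    have h6 : T ≤ (c - C) * ((n + 1 : ℕ) : ℝ) ^ 2 := by
      have := mul_le_mul_of_nonneg_left hLL hε.le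
      linarith
    have h5 : T * ((n + 1 : ℕ) : ℝ) ^ 2 ≤ (c - C) * ((n + 1 : ℕ) : ℝ) ^ 2 * ((n + 1 : ℕ) : ℝ) ^ 2 :=
      mul_le_mul_of_nonneg_right h6 hL2.le
    rw [hn, div_le_iff₀ (by positivity)]
    refine hside.trans ?_
    have hsq : ((n + 1 : ℕ) : ℝ) ^ 4 = ((n + 1 : ℕ) : ℝ) ^ 2 * ((n + 1 : ℕ) : ℝ) ^ 2 := by ring
    rw [hsq]
    nlinarith
  -- conclude
  by_contra hlt
  push Not at hlt
  have hmid : C < (C + liminf u atTop) / 2 := by linarith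
  have h := liminf_le_of_frequently_le ((hev _ hmid).frequently) hbdd
  linarith

/-! ### (g) Consistency with Theorem 40(e) on `U ≥ 320 g` -/

/-- **(g) Bookkeeping.** For `0 ≤ δ`, `0 < U`, `320 g ≤ U`: `(80 U δ + 640)/(U - 160 g) ≤ 160 δ + 1280/U`
(because `U/(U - 160 g) ≤ 2`), so (e′) followed by this inequality (`le_trans`) is a second proof of
Theorem 40(e) (`liminf_dWavePairFieldCorr_crutch_le_carrier`) on its domain `U > 0`, `320 g ≤ U`
(there `160 g < U` by `linarith`); the restatement itself is not repeated here (it is the landed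
declaration). [this work] -/
theorem strip_constant_le_of_le {U δ g : ℝ} (hδ0 : 0 ≤ δ) (hU : 0 < U) (hUg : 320 * g ≤ U) :
    (80 * U * δ + 640) / (U - 160 * g) ≤ 160 * δ + 1280 / U := by
  have hpos : 0 < U - 160 * g := by linarith
  rw [div_le_iff₀ hpos]
  have h1 : (160 * δ + 1280 / U) * (U - 160 * g) =
      160 * δ * (U - 160 * g) + 1280 * (U - 160 * g) / U := by ring
  have h2 : 640 ≤ 1280 * (U - 160 * g) / U := by
    rw [le_div_iff₀ hU]
    linarith
  have h3 : 80 * U * δ ≤ 160 * δ * (U - 160 * g) := by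
    nlinarith [mul_le_mul_of_nonneg_left hUg hδ0]
  rw [h1]
  linarith

end Summit.HubbardSuperconductivity.HubbardSuperconductivity.Theorems.CrutchCarrierCeilingStrip
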